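import Mathlib
import HarnessLib
import Summits.NavierStokesRegularity.FluidComputer.TriggeredTransferRelax

/-!
# Door N1-FC: a one-shot ENERGY reading and the door's AMPLITUDE clause — the dictionary for
# self-similar hand-overs, under a detection floor

Cell `ns-blowup`, seat `ns-blowup-fc-prover-2` (g4; D-0074 GROUP C «bridge support»; director-ns «OneShot →
Robust under the PREREG's detection floor»). LABEL: E–C typing / calibration. WHAT THIS IS NOT: not
Navier–Stokes evidence — exact identities for the energy of a zoomed multiple of one shape and real
inequalities; no scheme instance, no transfer and no blow-up is asserted; a MODEL cell's efficiency
reading `ηr ± δ` (PREREG-FC-TRIG-1 and -2, pub-fluidc) is a hypothesis letter here, never a tree fact.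

## Content

A model cell reads the ENERGY efficiency of one triggered transfer, `η_E = E(child) / E(parent)` (both at
their own scales), with a detection floor `δ`; the door `TriggerScheme.Step` certifies an AMPLITUDE clause
`growth · U ≤ U'`, `growth = (ηλ)^{1/2}`. For a SELF-SIMILAR hand-over — parent `U • G`, child
`x ↦ λ • (U' • G)(λ • (x - x₀))` = `zoom λ x₀ (U' • G)`, one shape `G` of finite non-zero energy — the two
are one reading:

* `lintegral_enorm_sq_smul_shape`, `lintegral_enorm_sq_zoom_smul`: `E(U • G) = U² E(G)`,
  `E(zoom λ x₀ (U' • G)) = (U'²/λ) E(G)`;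
* `sq_eq_of_selfSimilar_energy` / `eq_sqrt_mul_of_selfSimilar_energy`: if `E(child) = η_E · E(parent)` then
  `U'² = η_E λ U²`, i.e. `U' = (η_E λ)^{1/2} U` — the door's `growth` IS the energy-efficiency dictionary
  `Re_{k+1} = (ηλ)^{1/2} Re_k` for self-similar hand-overs (cf. `GadgetLedger.packetReynolds_succ`);
* `growth_mul_le_iff_eta_le_energyRatio`: for such a hand-over the amplitude clause of a scheme holds iff
  its efficiency floor is below the realised energy efficiency, `growth · U ≤ U' ↔ η ≤ η_E` (`U > 0`);
* **`growth_withEta_mul_le_of_energy_reading`**: a reading `|ηr - η_E| ≤ δ` certifies the amplitude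
  clause of the scheme with efficiency floor LOWERED to `ηr - δ` (`TriggerScheme.withEta`, p437827) —
  «OneShot → the door, under the detection floor», for self-similar hand-overs; the bar is `1/λ + δ`
  (`one_lt_eta_mul_lam_of_reading`), the negative reading is g3's `GadgetDetectionFloorNoGo`.

References: T. Tao, J. Amer. Math. Soc. 29 (2016) 601–674, §1.3 [cite: Tao2016AveragedNS, §1.3];
J. Leray, Acta Math. 63 (1934) §20 (similarity variables) [cite: Leray1934, §20]. 0 sorry; axioms ⊆
{propext, Classical.choice, Quot.sound}.
-/

noncomputable section

namespace Summit.NavierStokesRegularity.FluidComputer.TriggeredTransfer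

open Set MeasureTheory Function
open scoped ENNReal ContDiff NNReal
open Literature.Analysis.FluidPDE
open Literature.Analysis.FluidPDE.FluidComputer (E3 Vel)

/-! ## Energies of a scaled shape and of its zoom -/

/-- `E(U • G) = U² · E(G)`. [folklore] -/
theorem lintegral_enorm_sq_smul_shape (U : ℝ) (G : Vel) :
    ∫⁻ x, ‖(U • G) x‖ₑ ^ 2 = ENNReal.ofReal (U ^ 2) * ∫⁻ x, ‖G x‖ₑ ^ 2 := by
  simpa only [Pi.smul_apply] using lintegral_enorm_sq_const_smul volume U G

/-- **Energy of a self-similar hand-over slice**: `E(zoom λ x₀ (U' • G)) = (U'²/λ) · E(G)` (`λ > 0`;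
amplitude `× λU'`, volume `× λ⁻³`). [cite: Leray1934, §20] -/
theorem lintegral_enorm_sq_zoom_smul {lam : ℝ} (hlam : 0 < lam) (x₀ : E3) (U' : ℝ) (G : Vel) :
    ∫⁻ x, ‖zoom lam x₀ (U' • G) x‖ₑ ^ 2 = ENNReal.ofReal (U' ^ 2 / lam) * ∫⁻ x, ‖G x‖ₑ ^ 2 := by
  rw [lintegral_enorm_sq_zoom hlam, lintegral_enorm_sq_smul_shape, ← mul_assoc,
    ← ENNReal.ofReal_mul (sq_nonneg _), ← ENNReal.ofReal_mul (by positivity)]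
  congr 2
  field_simp

/-! ## The dictionary: energy efficiency ↔ amplitude ratio -/

/-- **`U'² = η_E λ U²` for a self-similar hand-over of energy efficiency `η_E`.** If the child slice
`zoom λ x₀ (U' • G)` has `η_E` times the energy of the parent `U • G` (one shape `G` of finite non-zero
energy, `η_E ≥ 0`), then `U'² = η_E · λ · U²`. [cite: Leray1934, §20] -/
theorem sq_eq_of_selfSimilar_energy {lam ηE U U' : ℝ} {x₀ : E3} {G : Vel} (hlam : 0 < lam)
    (hηE : 0 ≤ ηE) (hG0 : ∫⁻ x, ‖G x‖ₑ ^ 2 ≠ 0) (hGtop : ∫⁻ x, ‖G x‖ₑ ^ 2 ≠ ⊤)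
    (h : ∫⁻ x, ‖zoom lam x₀ (U' • G) x‖ₑ ^ 2 = ENNReal.ofReal ηE * ∫⁻ x, ‖(U • G) x‖ₑ ^ 2) :
    U' ^ 2 = ηE * lam * U ^ 2 := by
  rw [lintegral_enorm_sq_zoom_smul hlam, lintegral_enorm_sq_smul_shape, ← mul_assoc,
    ← ENNReal.ofReal_mul hηE, ENNReal.mul_left_inj hG0 hGtop,
    ENNReal.ofReal_eq_ofReal_iff (by positivity) (by positivity)] at h
  rw [div_eq_iff hlam.ne'] at h
  linarith [h]

/-- **`U' = (η_E λ)^{1/2} U`** (amplitudes `U, U' ≥ 0`): the door's growth factor `(ηλ)^{1/2}` IS the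
energy-efficiency dictionary `Re_{k+1} = (ηλ)^{1/2} Re_k` for self-similar hand-overs. [cite: Leray1934, §20] -/
theorem eq_sqrt_mul_of_selfSimilar_energy {lam ηE U U' : ℝ} {x₀ : E3} {G : Vel} (hlam : 0 < lam)
    (hηE : 0 ≤ ηE) (hU : 0 ≤ U) (hU' : 0 ≤ U') (hG0 : ∫⁻ x, ‖G x‖ₑ ^ 2 ≠ 0)
    (hGtop : ∫⁻ x, ‖G x‖ₑ ^ 2 ≠ ⊤)
    (h : ∫⁻ x, ‖zoom lam x₀ (U' • G) x‖ₑ ^ 2 = ENNReal.ofReal ηE * ∫⁻ x, ‖(U • G) x‖ₑ ^ 2) :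
    U' = Real.sqrt (ηE * lam) * U := by
  have hsq := sq_eq_of_selfSimilar_energy hlam hηE hG0 hGtop h
  have h1 : Real.sqrt (U' ^ 2) = Real.sqrt (ηE * lam * U ^ 2) := by rw [hsq]
  rwa [Real.sqrt_sq hU', Real.sqrt_mul (mul_nonneg hηE hlam.le), Real.sqrt_sq hU] at h1

namespace TriggerScheme

variable (𝒮 : TriggerScheme)

/-- **The amplitude clause is the efficiency comparison.** For a self-similar hand-over of energy
efficiency `η_E` from amplitude `U > 0`, the scheme's amplitude clause `growth · U ≤ U'` holds iff its
efficiency floor is at most the realised efficiency: `η ≤ η_E`. [folklore] -/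
theorem growth_mul_le_iff_eta_le_energyRatio {ηE U U' : ℝ} {x₀ : E3} {G : Vel} (hηE : 0 ≤ ηE)
    (hU : 0 < U) (hU' : 0 ≤ U') (hG0 : ∫⁻ x, ‖G x‖ₑ ^ 2 ≠ 0) (hGtop : ∫⁻ x, ‖G x‖ₑ ^ 2 ≠ ⊤)
    (h : ∫⁻ x, ‖zoom 𝒮.lam x₀ (U' • G) x‖ₑ ^ 2 = ENNReal.ofReal ηE * ∫⁻ x, ‖(U • G) x‖ₑ ^ 2) :
    𝒮.growth * U ≤ U' ↔ 𝒮.eta ≤ ηE := by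
  rw [eq_sqrt_mul_of_selfSimilar_energy 𝒮.lam_pos hηE hU.le hU' hG0 hGtop h]
  unfold growth
  rw [mul_le_mul_iff_left₀ hU,
    Real.sqrt_le_sqrt_iff (mul_nonneg hηE 𝒮.lam_pos.le), mul_le_mul_iff_left₀ 𝒮.lam_pos]

variable {𝒮}

/-- **OneShot energy reading → the door's amplitude clause, under a detection floor.** A self-similar
hand-over whose energy efficiency `η_E` is read as `ηr` with detection floor `δ` (`|ηr - η_E| ≤ δ`) meets
the amplitude clause of the scheme with efficiency floor lowered to `ηr - δ` — whenever `1 < λ (ηr - δ)`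
(Kelvin: the reading clears `1/λ + δ`) and `ηr - δ ≤ η`. [cite: Tao2016AveragedNS, §1.3] -/
theorem growth_withEta_mul_le_of_energy_reading {ηE ηr δ U U' : ℝ} {x₀ : E3} {G : Vel}
    (hηE : 0 ≤ ηE) (hU : 0 ≤ U) (hU' : 0 ≤ U') (hG0 : ∫⁻ x, ‖G x‖ₑ ^ 2 ≠ 0)
    (hGtop : ∫⁻ x, ‖G x‖ₑ ^ 2 ≠ ⊤)
    (h : ∫⁻ x, ‖zoom 𝒮.lam x₀ (U' • G) x‖ₑ ^ 2 = ENNReal.ofReal ηE * ∫⁻ x, ‖(U • G) x‖ₑ ^ 2)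
    (hread : |ηr - ηE| ≤ δ) (hK : 1 < (ηr - δ) * 𝒮.lam) (hle : ηr - δ ≤ 𝒮.eta) :
    (𝒮.withEta (ηr - δ) hK hle).growth * U ≤ U' :=
  growth_withEta_mul_le_of_reading hU hread
    (le_of_eq (eq_sqrt_mul_of_selfSimilar_energy 𝒮.lam_pos hηE hU hU' hG0 hGtop h).symm) hK hle

/-- The efficiency floor of a scheme is positive (`1 < ηλ`, `λ > 0`). [folklore] -/
theorem eta_pos (𝒮 : TriggerScheme) : 0 < 𝒮.eta := by
  by_contra h
  have h' : 𝒮.eta * 𝒮.lam ≤ 0 := mul_nonpos_of_nonpos_of_nonneg (not_lt.1 h) 𝒮.lam_pos.le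
  linarith [𝒮.kelvin]

/-- **The converse bookkeeping**: a self-similar hand-over meeting the amplitude clause of `𝒮` from
`U ≥ 0` has energy efficiency at least `η`: `η · E(parent) ≤ E(child)`. [folklore] -/
theorem eta_mul_energy_le_of_growth_mul_le {U U' : ℝ} (x₀ : E3) (G : Vel) (hU : 0 ≤ U)
    (hgrow : 𝒮.growth * U ≤ U') :
    ENNReal.ofReal 𝒮.eta * ∫⁻ x, ‖(U • G) x‖ₑ ^ 2 ≤ ∫⁻ x, ‖zoom 𝒮.lam x₀ (U' • G) x‖ₑ ^ 2 := by
  rw [lintegral_enorm_sq_zoom_smul 𝒮.lam_pos, lintegral_enorm_sq_smul_shape, ← mul_assoc,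
    ← ENNReal.ofReal_mul 𝒮.eta_pos.le]
  refine mul_le_mul_of_nonneg_right (ENNReal.ofReal_le_ofReal ?_) bot_le
  rw [le_div_iff₀ 𝒮.lam_pos]
  have h0 : 0 ≤ 𝒮.growth * U := mul_nonneg 𝒮.growth_pos.le hU
  have hsq : (𝒮.growth * U) ^ 2 ≤ U' ^ 2 := pow_le_pow_left₀ h0 hgrow 2
  calc 𝒮.eta * U ^ 2 * 𝒮.lam = 𝒮.growth ^ 2 * U ^ 2 := by rw [growth_sq]; ring
    _ = (𝒮.growth * U) ^ 2 := by ring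
    _ ≤ U' ^ 2 := hsq

end TriggerScheme

end Summit.NavierStokesRegularity.FluidComputer.TriggeredTransfer

end
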